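import Summits.Ventures.PercRepro.Night2SpreadCells

/-!
# PercRepro — FOUR MORE TWO-PARAMETER SPREAD REGIMES OF THE `(7, 5)` CELLS (night-2, gen 19)

`localShadowHall_dgenS_of_sum` with the pairs `(m₂, m₁)`: `(3, 1)`: `(3, 3)` (`c′ = 1/8`, `λ₂ = 19/360`,
`19 C(n,5) ≤ 9A + 72T`, `n ≥ 8`, minimum ratio `1.462`); `(3, 2)`: `(3, 4)` (`c′ = 1/12`, `λ₂ = 13/144`,
`13 C(n,4) ≤ 3A + 36T`, `n ≥ 7`, `1.378`); `(2, 1)`: `(3, 5)` (`c′ = λ₂ = 1/9`, `5 C(n,5) ≤ A + 9T`, `n ≥ 9`, `1.238`);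
`(2, 0)`: `(3, 4)` (`c′ = 2/9`, `λ₂ = 1/15`, `18 C(n,6) ≤ 10A + 45T`, `n ≥ 10`, `1.583`).  Same proof pattern as
`Night2SpreadCells`; theorems `localShadowHall_<cell>_five_of_spread3`.
-/

namespace PercRepro.Shadow

open Finset PerFlat ThmH

namespace DGenS

/-! ## The cell `(3, 1)` with `(m₂, m₁) = (3, 3)` -/

/-- `c′` at `(3, 1)`, `m₁ = 3`. -/
theorem cPrimeDGP_three_one_s3 : cPrimeDGP 5 3 5 1 3 = 1 / 8 := by
  unfold cPrimeDGP capDG reqDGP phiQ; norm_num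

/-- `λ₂` at `(3, 1)`, `m₂ = 3`. -/
theorem lambdaDGS_three_one_s3 : lambdaDGS 5 3 5 1 3 = 19 / 360 := by
  unfold lambdaDGS capDG reqDGP phiQ; norm_num

/-- The growth bound of the cell `(3, 1)` for `n ≥ 12`. -/
theorem three_one_growth_s3 {n : ℕ} (hn : 12 ≤ n) : 19 * n.choose 5 ≤ 9 * (n.choose 6 + n.choose 7) := by
  obtain ⟨m, rfl⟩ : ∃ m, n = m + 12 := ⟨n - 12, by omega⟩
  have h6 := Nat.choose_succ_right_eq (m + 12) 5
  have h7 := Nat.choose_succ_right_eq (m + 12) 6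
  rw [show m + 12 - 5 = m + 7 by omega] at h6
  rw [show m + 12 - 6 = m + 6 by omega] at h7
  have l1 : 7 * (m + 12).choose 5 ≤ 6 * (m + 12).choose 6 := by
    nlinarith [h6, Nat.zero_le ((m + 12).choose 5 * m)]
  have l2 : 6 * (m + 12).choose 6 ≤ 7 * (m + 12).choose 7 := by
    nlinarith [h7, Nat.zero_le ((m + 12).choose 6 * m)]
  omega

/-- The bounded range of the cell `(3, 1)`. -/
theorem three_one_sineq3_small {n : ℕ} (hn : 8 ≤ n) (hn' : n ≤ 11) :
    19 * n.choose 5 ≤ 9 * DGen.Aρt n 5 3 + 72 * DGen.Ttop n 3 := by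
  have hid : (∑ i ∈ Finset.range 6, n.choose i) + DGen.Aρt n 5 3 + DGen.Ttop n 3 = 2 ^ n :=
    DGen.sum_range_add_Aρt_add_Ttop (by omega)
  have key : 19 * n.choose 5 + 9 * (∑ i ∈ Finset.range 6, n.choose i) ≤ 9 * 2 ^ n + 63 * DGen.Ttop n 3 := by
    unfold DGen.Ttop
    interval_cases n <;> decide
  omega

/-- **The cell `(3, 1)` inequality** for every `n ≥ 8`. -/
theorem three_one_sineq3 {n : ℕ} (hn : 8 ≤ n) : 19 * n.choose 5 ≤ 9 * DGen.Aρt n 5 3 + 72 * DGen.Ttop n 3 := by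
  by_cases h : n ≤ 11
  · exact three_one_sineq3_small hn h
  · push Not at h
    have hA : n.choose 6 + n.choose 7 ≤ DGen.Aρt n 5 3 := DGen.Aρt_ge_two (by omega)
    have h2 := three_one_growth_s3 (by omega : 12 ≤ n)
    omega

/-- The target sum of the cell `(3, 1)` is at least `1` for every `n ≥ 8`. -/
theorem one_le_genSum_three_one_s3 {n : ℕ} (hn : 8 ≤ n) :
    1 ≤ DGenP.genSum n 5 3 (cPrimeDGP 5 3 5 1 3) (lambdaDGS 5 3 5 1 3) := by
  rw [cPrimeDGP_three_one_s3, lambdaDGS_three_one_s3, DGenP.genSum_eq (by omega) (by norm_num) (by norm_num)]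
  have hC : (0 : ℚ) < (n.choose 5 : ℚ) := by exact_mod_cast Nat.choose_pos (by omega)
  rw [le_div_iff₀ (by positivity)]
  have key' : (19 : ℚ) * (n.choose 5 : ℚ) ≤ 9 * (DGen.Aρt n 5 3 : ℚ) + 72 * (DGen.Ttop n 3 : ℚ) := by
    exact_mod_cast three_one_sineq3 hn
  norm_num
  linarith

/-! ## The cell `(3, 2)` with `(m₂, m₁) = (3, 4)` -/

/-- `c′` at `(3, 2)`, `m₁ = 4`. -/
theorem cPrimeDGP_three_two_s3 : cPrimeDGP 5 3 4 2 4 = 1 / 12 := by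
  unfold cPrimeDGP capDG reqDGP phiQ; norm_num

/-- `λ₂` at `(3, 2)`, `m₂ = 3`. -/
theorem lambdaDGS_three_two_s3 : lambdaDGS 5 3 4 2 3 = 13 / 144 := by
  unfold lambdaDGS capDG reqDGP phiQ; norm_num

/-- The growth bound of the cell `(3, 2)` for `n ≥ 14`. -/
theorem three_two_growth_s3 {n : ℕ} (hn : 14 ≤ n) : 13 * n.choose 4 ≤ 3 * (n.choose 5 + n.choose 6) := by
  obtain ⟨m, rfl⟩ : ∃ m, n = m + 14 := ⟨n - 14, by omega⟩
  have h5 := Nat.choose_succ_right_eq (m + 14) 4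
  have h6 := Nat.choose_succ_right_eq (m + 14) 5
  rw [show m + 14 - 4 = m + 10 by omega] at h5
  rw [show m + 14 - 5 = m + 9 by omega] at h6
  have l1 : 10 * (m + 14).choose 4 ≤ 5 * (m + 14).choose 5 := by
    nlinarith [h5, Nat.zero_le ((m + 14).choose 4 * m)]
  have l2 : 9 * (m + 14).choose 5 ≤ 6 * (m + 14).choose 6 := by
    nlinarith [h6, Nat.zero_le ((m + 14).choose 5 * m)]
  omega

/-- The bounded range of the cell `(3, 2)`. -/
theorem three_two_sineq3_small {n : ℕ} (hn : 7 ≤ n) (hn' : n ≤ 13) :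
    13 * n.choose 4 ≤ 3 * DGen.Aρt n 4 3 + 36 * DGen.Ttop n 3 := by
  have hid : (∑ i ∈ Finset.range 5, n.choose i) + DGen.Aρt n 4 3 + DGen.Ttop n 3 = 2 ^ n :=
    DGen.sum_range_add_Aρt_add_Ttop (by omega)
  have key : 13 * n.choose 4 + 3 * (∑ i ∈ Finset.range 5, n.choose i) ≤ 3 * 2 ^ n + 33 * DGen.Ttop n 3 := by
    unfold DGen.Ttop
    interval_cases n <;> decide
  omega

/-- **The cell `(3, 2)` inequality** for every `n ≥ 7`. -/
theorem three_two_sineq3 {n : ℕ} (hn : 7 ≤ n) : 13 * n.choose 4 ≤ 3 * DGen.Aρt n 4 3 + 36 * DGen.Ttop n 3 := by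
  by_cases h : n ≤ 13
  · exact three_two_sineq3_small hn h
  · push Not at h
    have hA : n.choose 5 + n.choose 6 ≤ DGen.Aρt n 4 3 := DGen.Aρt_ge_two (by omega)
    have h2 := three_two_growth_s3 (by omega : 14 ≤ n)
    omega

/-- The target sum of the cell `(3, 2)` is at least `1` for every `n ≥ 7`. -/
theorem one_le_genSum_three_two_s3 {n : ℕ} (hn : 7 ≤ n) :
    1 ≤ DGenP.genSum n 4 3 (cPrimeDGP 5 3 4 2 4) (lambdaDGS 5 3 4 2 3) := by
  rw [cPrimeDGP_three_two_s3, lambdaDGS_three_two_s3, DGenP.genSum_eq (by omega) (by norm_num) (by norm_num)]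
  have hC : (0 : ℚ) < (n.choose 4 : ℚ) := by exact_mod_cast Nat.choose_pos (by omega)
  rw [le_div_iff₀ (by positivity)]
  have key' : (13 : ℚ) * (n.choose 4 : ℚ) ≤ 3 * (DGen.Aρt n 4 3 : ℚ) + 36 * (DGen.Ttop n 3 : ℚ) := by
    exact_mod_cast three_two_sineq3 hn
  norm_num
  linarith

/-! ## The cell `(2, 1)` with `(m₂, m₁) = (3, 5)` -/

/-- `c′` at `(2, 1)`, `m₁ = 5`. -/
theorem cPrimeDGP_two_one_s3 : cPrimeDGP 5 2 5 1 5 = 1 / 9 := by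
  unfold cPrimeDGP capDG reqDGP phiQ; norm_num

/-- `λ₂` at `(2, 1)`, `m₂ = 3`. -/
theorem lambdaDGS_two_one_s3 : lambdaDGS 5 2 5 1 3 = 1 / 9 := by
  unfold lambdaDGS capDG reqDGP phiQ; norm_num

/-- The growth bound of the cell `(2, 1)` for `n ≥ 17`. -/
theorem two_one_growth_s3 {n : ℕ} (hn : 17 ≤ n) : 5 * n.choose 5 ≤ 1 * (n.choose 6 + n.choose 7) := by
  obtain ⟨m, rfl⟩ : ∃ m, n = m + 17 := ⟨n - 17, by omega⟩
  have h6 := Nat.choose_succ_right_eq (m + 17) 5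
  have h7 := Nat.choose_succ_right_eq (m + 17) 6
  rw [show m + 17 - 5 = m + 12 by omega] at h6
  rw [show m + 17 - 6 = m + 11 by omega] at h7
  have l1 : 12 * (m + 17).choose 5 ≤ 6 * (m + 17).choose 6 := by
    nlinarith [h6, Nat.zero_le ((m + 17).choose 5 * m)]
  have l2 : 11 * (m + 17).choose 6 ≤ 7 * (m + 17).choose 7 := by
    nlinarith [h7, Nat.zero_le ((m + 17).choose 6 * m)]
  omega

/-- The bounded range of the cell `(2, 1)`. -/
theorem two_one_sineq3_small {n : ℕ} (hn : 9 ≤ n) (hn' : n ≤ 16) :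
    5 * n.choose 5 ≤ 1 * DGen.Aρt n 5 4 + 9 * DGen.Ttop n 4 := by
  have hid : (∑ i ∈ Finset.range 6, n.choose i) + DGen.Aρt n 5 4 + DGen.Ttop n 4 = 2 ^ n :=
    DGen.sum_range_add_Aρt_add_Ttop (by omega)
  have key : 5 * n.choose 5 + 1 * (∑ i ∈ Finset.range 6, n.choose i) ≤ 1 * 2 ^ n + 8 * DGen.Ttop n 4 := by
    unfold DGen.Ttop
    interval_cases n <;> decide
  omega

/-- **The cell `(2, 1)` inequality** for every `n ≥ 9`. -/
theorem two_one_sineq3 {n : ℕ} (hn : 9 ≤ n) : 5 * n.choose 5 ≤ 1 * DGen.Aρt n 5 4 + 9 * DGen.Ttop n 4 := by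
  by_cases h : n ≤ 16
  · exact two_one_sineq3_small hn h
  · push Not at h
    have hA : n.choose 6 + n.choose 7 ≤ DGen.Aρt n 5 4 := DGen.Aρt_ge_two (by omega)
    have h2 := two_one_growth_s3 (by omega : 17 ≤ n)
    omega

/-- The target sum of the cell `(2, 1)` is at least `1` for every `n ≥ 9`. -/
theorem one_le_genSum_two_one_s3 {n : ℕ} (hn : 9 ≤ n) :
    1 ≤ DGenP.genSum n 5 4 (cPrimeDGP 5 2 5 1 5) (lambdaDGS 5 2 5 1 3) := by
  rw [cPrimeDGP_two_one_s3, lambdaDGS_two_one_s3, DGenP.genSum_eq (by omega) (by norm_num) (by norm_num)]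
  have hC : (0 : ℚ) < (n.choose 5 : ℚ) := by exact_mod_cast Nat.choose_pos (by omega)
  rw [le_div_iff₀ (by positivity)]
  have key' : (5 : ℚ) * (n.choose 5 : ℚ) ≤ 1 * (DGen.Aρt n 5 4 : ℚ) + 9 * (DGen.Ttop n 4 : ℚ) := by
    exact_mod_cast two_one_sineq3 hn
  norm_num
  linarith

/-! ## The cell `(2, 0)` with `(m₂, m₁) = (3, 4)` -/

/-- `c′` at `(2, 0)`, `m₁ = 4`. -/
theorem cPrimeDGP_two_zero_s3 : cPrimeDGP 5 2 6 0 4 = 2 / 9 := by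
  unfold cPrimeDGP capDG reqDGP phiQ; norm_num

/-- `λ₂` at `(2, 0)`, `m₂ = 3`. -/
theorem lambdaDGS_two_zero_s3 : lambdaDGS 5 2 6 0 3 = 1 / 15 := by
  unfold lambdaDGS capDG reqDGP phiQ; norm_num

/-- The growth bound of the cell `(2, 0)` for `n ≥ 14`. -/
theorem two_zero_growth_s3 {n : ℕ} (hn : 14 ≤ n) : 18 * n.choose 6 ≤ 10 * (n.choose 7 + n.choose 8) := by
  obtain ⟨m, rfl⟩ : ∃ m, n = m + 14 := ⟨n - 14, by omega⟩
  have h7 := Nat.choose_succ_right_eq (m + 14) 6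
  have h8 := Nat.choose_succ_right_eq (m + 14) 7
  rw [show m + 14 - 6 = m + 8 by omega] at h7
  rw [show m + 14 - 7 = m + 7 by omega] at h8
  have l1 : 8 * (m + 14).choose 6 ≤ 7 * (m + 14).choose 7 := by
    nlinarith [h7, Nat.zero_le ((m + 14).choose 6 * m)]
  have l2 : 7 * (m + 14).choose 7 ≤ 8 * (m + 14).choose 8 := by
    nlinarith [h8, Nat.zero_le ((m + 14).choose 7 * m)]
  omega

/-- The bounded range of the cell `(2, 0)`. -/
theorem two_zero_sineq3_small {n : ℕ} (hn : 10 ≤ n) (hn' : n ≤ 13) :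
    18 * n.choose 6 ≤ 10 * DGen.Aρt n 6 4 + 45 * DGen.Ttop n 4 := by
  have hid : (∑ i ∈ Finset.range 7, n.choose i) + DGen.Aρt n 6 4 + DGen.Ttop n 4 = 2 ^ n :=
    DGen.sum_range_add_Aρt_add_Ttop (by omega)
  have key : 18 * n.choose 6 + 10 * (∑ i ∈ Finset.range 7, n.choose i) ≤ 10 * 2 ^ n + 35 * DGen.Ttop n 4 := by
    unfold DGen.Ttop
    interval_cases n <;> decide
  omega

/-- **The cell `(2, 0)` inequality** for every `n ≥ 10`. -/
theorem two_zero_sineq3 {n : ℕ} (hn : 10 ≤ n) : 18 * n.choose 6 ≤ 10 * DGen.Aρt n 6 4 + 45 * DGen.Ttop n 4 := by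
  by_cases h : n ≤ 13
  · exact two_zero_sineq3_small hn h
  · push Not at h
    have hA : n.choose 7 + n.choose 8 ≤ DGen.Aρt n 6 4 := DGen.Aρt_ge_two (by omega)
    have h2 := two_zero_growth_s3 (by omega : 14 ≤ n)
    omega

/-- The target sum of the cell `(2, 0)` is at least `1` for every `n ≥ 10`. -/
theorem one_le_genSum_two_zero_s3 {n : ℕ} (hn : 10 ≤ n) :
    1 ≤ DGenP.genSum n 6 4 (cPrimeDGP 5 2 6 0 4) (lambdaDGS 5 2 6 0 3) := by
  rw [cPrimeDGP_two_zero_s3, lambdaDGS_two_zero_s3, DGenP.genSum_eq (by omega) (by norm_num) (by norm_num)]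
  have hC : (0 : ℚ) < (n.choose 6 : ℚ) := by exact_mod_cast Nat.choose_pos (by omega)
  rw [le_div_iff₀ (by positivity)]
  have key' : (18 : ℚ) * (n.choose 6 : ℚ) ≤ 10 * (DGen.Aρt n 6 4 : ℚ) + 45 * (DGen.Ttop n 4 : ℚ) := by
    exact_mod_cast two_zero_sineq3 hn
  norm_num
  linarith

end DGenS

variable {α : Type*} [DecidableEq α] {M : Matroid α} [M.Finite]

open scoped Classical in
/-- **THE `(7, 5)` CELL `(3, 1)` IN THE `(3, 3)`-SPREAD REGIME**. -/
theorem localShadowHall_three_one_five_of_spread3 {G : Finset α} (hG : G ∈ flatsQ M (5 + 1))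
    (hd : (gr M \ G).card = 3) (hk : kColoops M G = 1)
    (hs : ∀ e ∈ gr M, ∀ f ∈ gr M, e ≠ f → rkN M {e, f} = 2) (hl : ∀ e ∈ gr M, M.Indep {e})
    (hm₁ : ∀ B ∈ thinMembers M 5 G, 5 ≤ (B \ coloops M G).card → 3 ≤ (G \ clF M B).card)
    (hm₂ : ∀ B ∈ thinMembers M 5 G, (B \ coloops M G).card + 1 = 5 → 3 ≤ (G \ clF M B).card) :
    LocalShadowHall M 5 G := by
  by_cases hn : 8 ≤ G.card - kColoops M G
  · exact localShadowHall_dgenS_of_sum (d := 3) (ρ := 5) (m₁ := 3) (m₂ := 3) hG hd (by norm_num) (by rw [hk])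
      (by norm_num) (by omega) hs hl (by rw [hk, DGenS.cPrimeDGP_three_one_s3]; norm_num)
      (by rw [hk, DGenS.lambdaDGS_three_one_s3]; norm_num) hm₁ hm₂
      (by rw [hk] at hn ⊢; exact DGenS.one_le_genSum_three_one_s3 hn)
  · exact localShadowHall_of_spread (ρ := 5) (m₀ := 6) hG hd (by norm_num) (by rw [hk])
      (fun B hB => absurd (thin_card_bound (ρ := 5) hG hd (by norm_num) (by rw [hk]) hB) (by omega))
      (by rw [hk]; unfold phiQ; norm_num)

open scoped Classical in
/-- **THE `(7, 5)` CELL `(3, 2)` IN THE `(3, 4)`-SPREAD REGIME**. -/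
theorem localShadowHall_three_two_five_of_spread3 {G : Finset α} (hG : G ∈ flatsQ M (5 + 1))
    (hd : (gr M \ G).card = 3) (hk : kColoops M G = 2)
    (hs : ∀ e ∈ gr M, ∀ f ∈ gr M, e ≠ f → rkN M {e, f} = 2) (hl : ∀ e ∈ gr M, M.Indep {e})
    (hm₁ : ∀ B ∈ thinMembers M 5 G, 4 ≤ (B \ coloops M G).card → 4 ≤ (G \ clF M B).card)
    (hm₂ : ∀ B ∈ thinMembers M 5 G, (B \ coloops M G).card + 1 = 4 → 3 ≤ (G \ clF M B).card) :
    LocalShadowHall M 5 G := by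
  by_cases hn : 7 ≤ G.card - kColoops M G
  · exact localShadowHall_dgenS_of_sum (d := 3) (ρ := 4) (m₁ := 4) (m₂ := 3) hG hd (by norm_num) (by rw [hk])
      (by norm_num) (by omega) hs hl (by rw [hk, DGenS.cPrimeDGP_three_two_s3]; norm_num)
      (by rw [hk, DGenS.lambdaDGS_three_two_s3]; norm_num) hm₁ hm₂
      (by rw [hk] at hn ⊢; exact DGenS.one_le_genSum_three_two_s3 hn)
  · exact localShadowHall_of_spread (ρ := 4) (m₀ := 9) hG hd (by norm_num) (by rw [hk])
      (fun B hB => absurd (thin_card_bound (ρ := 4) hG hd (by norm_num) (by rw [hk]) hB) (by omega))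
      (by rw [hk]; unfold phiQ; norm_num)

open scoped Classical in
/-- **THE `(7, 5)` CELL `(2, 1)` IN THE `(3, 5)`-SPREAD REGIME**. -/
theorem localShadowHall_two_one_five_of_spread3 {G : Finset α} (hG : G ∈ flatsQ M (5 + 1))
    (hd : (gr M \ G).card = 2) (hk : kColoops M G = 1)
    (hs : ∀ e ∈ gr M, ∀ f ∈ gr M, e ≠ f → rkN M {e, f} = 2) (hl : ∀ e ∈ gr M, M.Indep {e})
    (hm₁ : ∀ B ∈ thinMembers M 5 G, 5 ≤ (B \ coloops M G).card → 5 ≤ (G \ clF M B).card)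
    (hm₂ : ∀ B ∈ thinMembers M 5 G, (B \ coloops M G).card + 1 = 5 → 3 ≤ (G \ clF M B).card) :
    LocalShadowHall M 5 G := by
  by_cases hn : 9 ≤ G.card - kColoops M G
  · exact localShadowHall_dgenS_of_sum (d := 2) (ρ := 5) (m₁ := 5) (m₂ := 3) hG hd (by norm_num) (by rw [hk])
      (by norm_num) (by omega) hs hl (by rw [hk, DGenS.cPrimeDGP_two_one_s3]; norm_num)
      (by rw [hk, DGenS.lambdaDGS_two_one_s3]; norm_num) hm₁ hm₂
      (by rw [hk] at hn ⊢; exact DGenS.one_le_genSum_two_one_s3 hn)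
  · exact localShadowHall_of_spread (ρ := 5) (m₀ := 8) hG hd (by norm_num) (by rw [hk])
      (fun B hB => absurd (thin_card_bound (ρ := 5) hG hd (by norm_num) (by rw [hk]) hB) (by omega))
      (by rw [hk]; unfold phiQ; norm_num)

open scoped Classical in
/-- **THE `(7, 5)` CELL `(2, 0)` IN THE `(3, 4)`-SPREAD REGIME**. -/
theorem localShadowHall_two_zero_five_of_spread3 {G : Finset α} (hG : G ∈ flatsQ M (5 + 1))
    (hd : (gr M \ G).card = 2) (hk : kColoops M G = 0)
    (hs : ∀ e ∈ gr M, ∀ f ∈ gr M, e ≠ f → rkN M {e, f} = 2) (hl : ∀ e ∈ gr M, M.Indep {e})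
    (hm₁ : ∀ B ∈ thinMembers M 5 G, 6 ≤ (B \ coloops M G).card → 4 ≤ (G \ clF M B).card)
    (hm₂ : ∀ B ∈ thinMembers M 5 G, (B \ coloops M G).card + 1 = 6 → 3 ≤ (G \ clF M B).card) :
    LocalShadowHall M 5 G := by
  by_cases hn : 10 ≤ G.card - kColoops M G
  · exact localShadowHall_dgenS_of_sum (d := 2) (ρ := 6) (m₁ := 4) (m₂ := 3) hG hd (by norm_num) (by rw [hk])
      (by norm_num) (by omega) hs hl (by rw [hk, DGenS.cPrimeDGP_two_zero_s3]; norm_num)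
      (by rw [hk, DGenS.lambdaDGS_two_zero_s3]; norm_num) hm₁ hm₂
      (by rw [hk] at hn ⊢; exact DGenS.one_le_genSum_two_zero_s3 hn)
  · exact localShadowHall_of_spread (ρ := 6) (m₀ := 5) hG hd (by norm_num) (by rw [hk])
      (fun B hB => absurd (thin_card_bound (ρ := 6) hG hd (by norm_num) (by rw [hk]) hB) (by omega))
      (by rw [hk]; unfold phiQ; norm_num)

end PercRepro.Shadow
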